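import Mathlib
import HarnessLib

/-!
# Two tools for the thermodynamic limit: restriction of product measures to distinct coordinates; a squeeze along `(L+1)²`

HONEST FRAMING: exact (Metropolis-corrected) sampling algorithms for lattice gauge theory;
figures of merit are autocorrelation/cost numbers at stated couplings and volumes; no
continuum-physics claim.

Venture `LatticeQCDFlow` (cell pub-lqcd), sub-topic `Scoring`; FANOUT row 5 (`s0-sun-a`), GEN-19.  Generic lemmas
used by `TorusWilsonLoopLimit2D` / `TorusCylinderLimit2D` (the thermodynamic limit of two-dimensional lattice
Yang–Mills):

* `measurePreserving_comp_of_injective` — for a probability measure `μ`, finite index types and an injective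
  `c : κ → E`, the coordinate restriction `x ↦ x ∘ c` pushes `μ^{⊗E}` to `μ^{⊗κ}` (cf. the `Fin m`-indexed
  `PlanarGauge.measurePreserving_restrict_coords`);
* `tendsto_of_eventually_abs_sub_le_mul_pow`, `tendsto_of_abs_sub_le_mul_pow` — if `|f L − a| ≤ K q^{(L+1)² − k − 1}`
  for all large `L` with `0 ≤ q < 1`, then `f L → a`.

No `def`, nothing cited as a fact, 0 sorry.
-/

noncomputable section

open MeasureTheory Function Filter Topology

namespace Summit.Ventures.LatticeQCDFlow.Scoring

/-- **Restricting a finite product of copies of a probability measure to distinct coordinates is measure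
preserving** (any index types; `piEquivPiSubtypeProd` onto the range, then relabelling by
`Equiv.ofInjective`; cf. `PlanarGauge.measurePreserving_restrict_coords`). -/
theorem measurePreserving_comp_of_injective {E κ Y : Type*} [Fintype E] [Fintype κ] [MeasurableSpace Y]
    (μ : Measure Y) [IsProbabilityMeasure μ] {c : κ → E} (hc : Injective c) :
    MeasurePreserving (fun (x : E → Y) (i : κ) => x (c i)) (Measure.pi fun _ : E => μ)
      (Measure.pi fun _ : κ => μ) := by
  classical
  set p : E → Prop := fun e => e ∈ Set.range c with hp
  letI : Fintype (Subtype p) := Subtype.fintype p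
  have h1 := measurePreserving_fst.comp (measurePreserving_piEquivPiSubtypeProd (fun _ : E => μ) p)
  set f : Subtype p ≃ κ := (Equiv.ofInjective c hc).symm with hf
  have h := (measurePreserving_piCongrLeft (fun _ : κ => μ) f).comp h1
  have he : (⇑(MeasurableEquiv.piCongrLeft (fun _ : κ => Y) f) ∘
      (Prod.fst ∘ ⇑(MeasurableEquiv.piEquivPiSubtypeProd (fun _ : E => Y) p))) =
      fun (x : E → Y) (i : κ) => x (c i) := by
    funext x i
    simp only [comp_apply, MeasurableEquiv.coe_piCongrLeft, Equiv.piCongrLeft_apply_eq_cast, cast_eq, hf,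
      Equiv.symm_symm]
    rfl
  rw [he] at h
  exact h

/-- Squeeze, eventually form: if `|f L − a| ≤ K q^{(L+1)² − k − 1}` for all large `L` with `0 ≤ q < 1`, then
`f L → a`. -/
theorem tendsto_of_eventually_abs_sub_le_mul_pow {f : ℕ → ℝ} {a K q : ℝ} {k : ℕ} (hq0 : 0 ≤ q)
    (hq1 : q < 1) (h : ∀ᶠ L : ℕ in atTop, |f L - a| ≤ K * q ^ ((L + 1) ^ 2 - k - 1)) :
    Tendsto f atTop (𝓝 a) := by
  have hexp : Tendsto (fun L : ℕ => (L + 1) ^ 2 - k - 1) atTop atTop := by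
    refine tendsto_atTop_atTop.mpr fun b => ⟨b + k + 1, fun L hL => ?_⟩
    have : L + 1 ≤ (L + 1) ^ 2 := Nat.le_self_pow (by norm_num) _
    omega
  have hpow : Tendsto (fun L : ℕ => K * q ^ ((L + 1) ^ 2 - k - 1)) atTop (𝓝 0) := by
    have h := (tendsto_pow_atTop_nhds_zero_of_lt_one hq0 hq1).comp hexp
    simpa using h.const_mul K
  rw [← tendsto_sub_nhds_zero_iff]
  refine squeeze_zero_norm' (h.mono fun L hL => ?_) hpow
  rw [Real.norm_eq_abs]
  exact hL

/-- Squeeze: if `|f L − a| ≤ K q^{(L+1)² − k − 1}` for `L ≥ L₀` with `0 ≤ q < 1`, then `f L → a`. -/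
theorem tendsto_of_abs_sub_le_mul_pow {f : ℕ → ℝ} {a K q : ℝ} {k L₀ : ℕ} (hq0 : 0 ≤ q) (hq1 : q < 1)
    (h : ∀ L, L₀ ≤ L → |f L - a| ≤ K * q ^ ((L + 1) ^ 2 - k - 1)) :
    Tendsto f atTop (𝓝 a) :=
  tendsto_of_eventually_abs_sub_le_mul_pow hq0 hq1 (Filter.eventually_atTop.2 ⟨L₀, h⟩)

end Summit.Ventures.LatticeQCDFlow.Scoring
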